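import Summits.QuantumFields.GaugeBoot.BootstrapCouplingJump
import Summits.QuantumFields.GaugeBoot.OrbitAverageOperator
import HarnessLib

/-!
# One-link Haar averages and the ANOVA annihilator: `n + 1` distinct one-link centrings kill every word of length `≤ n` (gauge-boot, L1/L4 supplement)

HONEST FRAMING (cell `pub-gaugeboot`, page 1 of every file): the venture produces certified bounds
on lattice expectations at stated coupling, gauge group, dimension and torus size; NOT a mass gap,
NOT a continuum limit, NOT a string tension; NOT Yang–Mills-summit-bearing (barriers
`FixedCouplingUltralocality`, `PerturbativeInvisibility`). Structural; it certifies no number.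

## Content (the tool that makes the jump of `BootstrapCouplingJump` unconditional)

`BootstrapCouplingJump` proves that the level-`n` SDP value of `P = f · ∂_{i,a}S` jumps at `β = 0`
as soon as `P ∉ V_n` (the span of the words of length `≤ n`). To DECIDE `P ∉ V_n` for an explicit
`P` we use locality instead of degree: a word of length `≤ n` depends on at most `n` links.

* `linkAct l`, `linkAvg l` — left multiplication by `G` at the link `l` and its Haar average
  `(E_l f)(U) = ∫ f(U[l ↦ g U_l]) dg = ∫ f(U[l ↦ g]) dg` (`OrbitAverageOperator.avgL`);
* `IndepOf l f` (`f (U[l ↦ x]) = f U`): `linkAvg_eq_self_of_indepOf`, `indepOf_linkAvg_self`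
  (`E_l f` no longer depends on `l`), `indepOf_linkAvg` (independence of other links is preserved),
  `linkAvg_mul_of_indepOf` (independent factors come out), `indepOf_of_mem_wordSpace`
  (locality of word spaces);
* `killL e k = (1 - E_{e_{k-1}}) ∘ ⋯ ∘ (1 - E_{e_0})` — the ANOVA / Efron–Stein annihilator;
  `killL_eq_zero_of_indepOf` (a function independent of some `e_j`, `j < k`, is killed);
* ★★ `exists_card_le_indepOf_of_mem_wordsUpTo` — a word of length `≤ n` is independent of every
  link outside a set of at most `n` links; ★★★ `killL_eq_zero_of_mem_wordTruncation` — for `n + 1`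
  DISTINCT links `e_0, …, e_n`, `killL e (n+1)` kills all of `V_n` (pigeonhole).

References: B. Efron, C. Stein, Ann. Statist. 9 (1981) 586 (the ANOVA decomposition); W. Hoeffding
(1948). Folklore.
-/

noncomputable section

open MeasureTheory Filter Topology
open Literature.MathematicalPhysics.QuantumFieldTheory (LatticeRep haarProbability)

namespace Summit.QuantumFields.GaugeBoot

section LinkAvg

variable {ι : Type*} [DecidableEq ι] {G : Type*} [Group G] [TopologicalSpace G] [IsTopologicalGroup G]
  [CompactSpace G] [MeasurableSpace G] [BorelSpace G]

/-- **Left multiplication at the link `l`**: `(g, U) ↦ U[l ↦ g U_l]`. [folklore] -/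
def linkAct (l : ι) (g : G) (U : ι → G) : ι → G := Function.update U l (g * U l)

omit [TopologicalSpace G] [IsTopologicalGroup G] [CompactSpace G] [MeasurableSpace G] [BorelSpace G] in
/-- `linkAct` evaluated. -/
@[simp] theorem linkAct_apply (l : ι) (g : G) (U : ι → G) : linkAct l g U = Function.update U l (g * U l) := rfl

omit [CompactSpace G] [MeasurableSpace G] [BorelSpace G] in
/-- The one-link action is jointly continuous. -/
theorem continuous_linkAct (l : ι) : Continuous fun p : G × (ι → G) => linkAct l p.1 p.2 := by
  simp only [linkAct]
  exact continuous_snd.update l (continuous_fst.mul ((continuous_apply l).comp continuous_snd))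

/-- **The one-link Haar average** `E_l` as a linear operator on the continuous observables.
[folklore] -/
def linkAvg (l : ι) : C(ι → G, ℝ) →ₗ[ℝ] C(ι → G, ℝ) := avgL (linkAct l) (continuous_linkAct l)

/-- `(E_l f)(U) = ∫ f(U[l ↦ g U_l]) dg`. -/
theorem linkAvg_apply (l : ι) (f : C(ι → G, ℝ)) (U : ι → G) :
    linkAvg l f U = ∫ g, f (Function.update U l (g * U l)) ∂haarProbability G := by
  rw [linkAvg, avgL_apply]
  rfl

/-- `(E_l f)(U) = ∫ f(U[l ↦ g]) dg` (right invariance of the Haar measure). -/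
theorem linkAvg_apply' (l : ι) (f : C(ι → G, ℝ)) (U : ι → G) :
    linkAvg l f U = ∫ g, f (Function.update U l g) ∂haarProbability G := by
  rw [linkAvg_apply]
  exact integral_mul_right_eq_self (μ := haarProbability G) (fun g => f (Function.update U l g)) (U l)

/-- **`f` does not depend on the link `l`.** [shape] A parametric definition of a proposition —
NOT a fact. [folklore] -/
def IndepOf (l : ι) (f : C(ι → G, ℝ)) : Prop := ∀ (U : ι → G) (x : G), f (Function.update U l x) = f U

omit [Group G] [IsTopologicalGroup G] [CompactSpace G] [MeasurableSpace G] [BorelSpace G] in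
/-- Constants depend on no link. -/
theorem indepOf_const (l : ι) (c : ℝ) : IndepOf (G := G) l (c • (1 : C(ι → G, ℝ))) := fun _ _ => rfl

omit [Group G] [IsTopologicalGroup G] [CompactSpace G] [MeasurableSpace G] [BorelSpace G] in
/-- Products of independent functions are independent. -/
theorem IndepOf.mul {l : ι} {f g : C(ι → G, ℝ)} (hf : IndepOf l f) (hg : IndepOf l g) :
    IndepOf l (f * g) := fun U x => by
  rw [ContinuousMap.mul_apply, ContinuousMap.mul_apply, hf, hg]

omit [Group G] [IsTopologicalGroup G] [CompactSpace G] [MeasurableSpace G] [BorelSpace G] in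
/-- Differences of independent functions are independent. -/
theorem IndepOf.sub {l : ι} {f g : C(ι → G, ℝ)} (hf : IndepOf l f) (hg : IndepOf l g) :
    IndepOf l (f - g) := fun U x => by
  rw [ContinuousMap.sub_apply, ContinuousMap.sub_apply, hf, hg]

omit [Group G] [IsTopologicalGroup G] [CompactSpace G] [MeasurableSpace G] [BorelSpace G] in
/-- Finite products of independent functions are independent. -/
theorem IndepOf.prod {l : ι} {α : Type*} (s : Finset α) {f : α → C(ι → G, ℝ)}
    (hf : ∀ a ∈ s, IndepOf l (f a)) : IndepOf l (∏ a ∈ s, f a) := by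
  classical
  induction s using Finset.induction_on with
  | empty => simpa using indepOf_const (G := G) l 1
  | insert a s ha ih =>
    rw [Finset.prod_insert ha]
    exact (hf a (Finset.mem_insert_self a s)).mul (ih fun b hb => hf b (Finset.mem_insert_of_mem hb))

omit [IsTopologicalGroup G] [CompactSpace G] [MeasurableSpace G] [BorelSpace G] in
/-- **Locality of word spaces**: an element of `wordSpace r S n` does not depend on the links
outside `S`. -/
theorem indepOf_of_mem_wordSpace (r : LatticeRep G) {S : Set ι} {n : ℕ} {f : C(ι → G, ℝ)}
    (hf : f ∈ wordSpace r S n) {l : ι} (hl : l ∉ S) : IndepOf l f := fun U x =>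
  apply_eq_of_mem_wordSpace r hf fun i hi => by
    rw [Function.update_of_ne (by rintro rfl; exact hl hi)]

/-- **`E_l` fixes the functions independent of `l`.** -/
theorem linkAvg_eq_self_of_indepOf {l : ι} {f : C(ι → G, ℝ)} (hf : IndepOf l f) : linkAvg l f = f :=
  avgL_of_invariant (continuous_linkAct l) fun g U => hf U (g * U l)

/-- **`E_l f` does not depend on `l`.** -/
theorem indepOf_linkAvg_self (l : ι) (f : C(ι → G, ℝ)) : IndepOf l (linkAvg l f) := fun U x => by
  rw [linkAvg_apply', linkAvg_apply']
  simp only [Function.update_idem]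

/-- **`E_l` preserves independence of another link.** -/
theorem indepOf_linkAvg_of_ne {l l' : ι} {f : C(ι → G, ℝ)} (hf : IndepOf l' f) (l_ne : l ≠ l') :
    IndepOf l' (linkAvg l f) := fun U x => by
  rw [linkAvg_apply', linkAvg_apply']
  refine integral_congr_ae (Eventually.of_forall fun g => ?_)
  show f (Function.update (Function.update U l' x) l g) = f (Function.update U l g)
  rw [Function.update_comm l_ne.symm, hf]

/-- `E_l` preserves independence of any link (for `l' = l` the average is independent anyway). -/
theorem indepOf_linkAvg {l l' : ι} {f : C(ι → G, ℝ)} (hf : IndepOf l' f) :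
    IndepOf l' (linkAvg l f) := by
  by_cases h : l = l'
  · subst h; exact indepOf_linkAvg_self l f
  · exact indepOf_linkAvg_of_ne hf h

/-- **Independent factors come out of `E_l`**: `E_l (f g) = f · E_l g` for `f` independent of `l`.
-/
theorem linkAvg_mul_of_indepOf {l : ι} {f : C(ι → G, ℝ)} (hf : IndepOf l f) (g : C(ι → G, ℝ)) :
    linkAvg l (f * g) = f * linkAvg l g :=
  avgL_invariant_mul (continuous_linkAct l) g fun h U => hf U (h * U l)

/-- `E_l (g f) = E_l g · f` for `f` independent of `l`. -/
theorem linkAvg_mul_of_indepOf' {l : ι} {f : C(ι → G, ℝ)} (hf : IndepOf l f) (g : C(ι → G, ℝ)) :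
    linkAvg l (g * f) = linkAvg l g * f :=
  avgL_mul_of_invariant (continuous_linkAct l) g fun h U => hf U (h * U l)

/-! ## The annihilator -/

/-- **The ANOVA annihilator** along the sequence of links `e`: `killL e 0 = id`,
`killL e (k+1) = (id - E_{e k}) ∘ killL e k`. [cite: EfronStein1981] -/
def killL (e : ℕ → ι) : ℕ → (C(ι → G, ℝ) →ₗ[ℝ] C(ι → G, ℝ))
  | 0 => LinearMap.id
  | k + 1 => (LinearMap.id - linkAvg (e k)) ∘ₗ killL e k

/-- `killL` at `0`. -/
@[simp] theorem killL_zero (e : ℕ → ι) (f : C(ι → G, ℝ)) : killL e 0 f = f := rfl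

/-- The recursion of `killL`. -/
theorem killL_succ (e : ℕ → ι) (k : ℕ) (f : C(ι → G, ℝ)) :
    killL e (k + 1) f = killL e k f - linkAvg (e k) (killL e k f) := rfl

/-- **`killL` preserves independence of any link.** -/
theorem indepOf_killL {l : ι} {f : C(ι → G, ℝ)} (hf : IndepOf l f) (e : ℕ → ι) (k : ℕ) :
    IndepOf l (killL e k f) := by
  induction k with
  | zero => exact hf
  | succ k ih => rw [killL_succ]; exact ih.sub (indepOf_linkAvg ih)

/-- ★ **A function independent of `e j` is killed by `killL e k` for every `k > j`.** -/
theorem killL_eq_zero_of_indepOf {e : ℕ → ι} {f : C(ι → G, ℝ)} {j : ℕ} (hf : IndepOf (e j) f)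
    {k : ℕ} (hjk : j < k) : killL e k f = 0 := by
  induction k with
  | zero => exact absurd hjk (Nat.not_lt_zero _)
  | succ k ih =>
    rw [killL_succ]
    rcases Nat.lt_succ_iff_lt_or_eq.1 hjk with h | h
    · rw [ih h, map_zero, sub_zero]
    · subst h
      rw [linkAvg_eq_self_of_indepOf (indepOf_killL hf e j), sub_self]

/-! ## Words depend on few links -/

omit [IsTopologicalGroup G] [CompactSpace G] [MeasurableSpace G] [BorelSpace G] in
/-- A generator depends on one link only. -/
theorem exists_indepOf_of_mem_entryGens (r : LatticeRep G) {x : C(ι → G, ℝ)}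
    (hx : x ∈ entryGens (ι := ι) r) : ∃ e₀ : ι, ∀ l, l ≠ e₀ → IndepOf l x := by
  rcases hx with ⟨⟨e₀, a, b⟩, rfl⟩ | ⟨⟨e₀, a, b⟩, rfl⟩
  · exact ⟨e₀, fun l hl U y => by simp [reEntry_apply, Function.update_of_ne hl.symm]⟩
  · exact ⟨e₀, fun l hl U y => by simp [imEntry_apply, Function.update_of_ne hl.symm]⟩

omit [IsTopologicalGroup G] [CompactSpace G] [MeasurableSpace G] [BorelSpace G] in
/-- ★★ **A word of length `≤ n` depends on at most `n` links.** -/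
theorem exists_card_le_indepOf_of_mem_wordsUpTo (r : LatticeRep G) {n : ℕ} {w : C(ι → G, ℝ)}
    (hw : w ∈ wordsUpTo (ι := ι) r n) :
    ∃ T : Finset ι, T.card ≤ n ∧ ∀ l, l ∉ T → IndepOf l w := by
  classical
  obtain ⟨lst, hl, hlen, rfl⟩ := hw
  induction lst generalizing n with
  | nil => exact ⟨∅, by simp, fun l _ U y => by simp⟩
  | cons x lst ih =>
    obtain ⟨e₀, he₀⟩ := exists_indepOf_of_mem_entryGens r (hl x List.mem_cons_self)
    obtain ⟨T, hT, hTi⟩ := ih (n := lst.length) (fun y hy => hl y (List.mem_cons_of_mem x hy)) le_rfl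
    refine ⟨insert e₀ T, ?_, fun l hlT => ?_⟩
    · calc (insert e₀ T).card ≤ T.card + 1 := Finset.card_insert_le _ _
        _ ≤ lst.length + 1 := by omega
        _ = (x :: lst).length := by simp
        _ ≤ n := hlen
    · rw [Finset.mem_insert, not_or] at hlT
      rw [List.prod_cons]
      exact (he₀ l hlT.1).mul (hTi l hlT.2)

/-- ★★★ **`n + 1` distinct one-link centrings kill every word of length `≤ n`** (some `e j`,
`j ≤ n`, is not among the `≤ n` links of the word — pigeonhole). -/
theorem killL_eq_zero_of_mem_wordsUpTo (r : LatticeRep G) {n : ℕ} {e : ℕ → ι}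
    (he : Set.InjOn e (Set.Iio (n + 1))) {w : C(ι → G, ℝ)} (hw : w ∈ wordsUpTo (ι := ι) r n) :
    killL e (n + 1) w = 0 := by
  classical
  obtain ⟨T, hT, hTi⟩ := exists_card_le_indepOf_of_mem_wordsUpTo r hw
  -- some `e j`, `j ≤ n`, lies outside `T`
  obtain ⟨j, hj, hjT⟩ : ∃ j, j < n + 1 ∧ e j ∉ T := by
    by_contra h
    simp only [not_exists, not_and, not_not] at h
    have hmaps : Set.MapsTo e (↑(Finset.range (n + 1)) : Set ℕ) (↑T : Set ι) := fun j hj =>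
      h j (Finset.mem_range.1 hj)
    have hinj : Set.InjOn e (↑(Finset.range (n + 1)) : Set ℕ) := fun a ha b hb hab =>
      he (Finset.mem_range.1 ha) (Finset.mem_range.1 hb) hab
    have hcard := Finset.card_le_card_of_injOn e hmaps hinj
    rw [Finset.card_range] at hcard
    omega
  exact killL_eq_zero_of_indepOf (hTi _ hjT) hj

/-- ★★★ **The annihilator of `n + 1` distinct links kills `V_n`**, the span of the words of length
`≤ n`. [cite: EfronStein1981] -/
theorem killL_eq_zero_of_mem_wordTruncation (r : LatticeRep G) {n : ℕ} {e : ℕ → ι}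
    (he : Set.InjOn e (Set.Iio (n + 1))) {v : C(ι → G, ℝ)} (hv : v ∈ wordTruncation (ι := ι) r n) :
    killL e (n + 1) v = 0 := by
  have h : Submodule.span ℝ (wordsUpTo (ι := ι) r n) ≤ LinearMap.ker (killL (G := G) e (n + 1)) :=
    Submodule.span_le.2 fun w hw => LinearMap.mem_ker.2 (killL_eq_zero_of_mem_wordsUpTo r he hw)
  exact LinearMap.mem_ker.1 (h hv)

end LinkAvg

end Summit.QuantumFields.GaugeBoot

end
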